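import Summits.QuantumFields.YangMills.Theorems.BalabanUVNodesN11CompatibleInitialSegmentSplit
import Literature.MathematicalPhysics.QuantumFieldTheory.Balaban1983to89.Node00.StepWeightsOfRecord

/-!
# DAG node N11 — THE (2.18) HISTORIES ON THE ONE-BLOCK TAIL: at a one-block level `j` (the 𝐃_j-cube of record exceeds the torus) every admissible sequence has `Ω_j, Λ_j ∈ {∅, T}`,
# hence exactly three patterns `(Ω_j, Λ_j) ∈ {(T,T), (T,∅), (∅,∅)}`; `Λ_j = T` forces the ALL-SMALL history `Ω_i = Λ_i = T` for all `i ≤ j`, `Λ_j = ∅` kills every later level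
# (`Ω_i = Λ_i = ∅`, `i > j`), and the large-field region `Z_k` at a one-block top level is NOTHING or EVERYTHING — along a (2.6)-run this is the whole story above the last
# compatible level `n₀` of `…N11CompatibleInitialSegmentSplit`

HEADER — WORK-UNIT METADATA.  Cell `pub-ymgap`, YM-PLAN Track A (HUMAN RULING D-0062 ∕ D-0149 width seats), seat `pub-ymgap-dag-n11-w4` (g5; WIDTH SEAT 4 of 4 on NODE n11
[B14]), route `BalabanUVNodes` rev 29, deciding item K1⁹ `StabilityBRunRowsAtRecordR13SepCoPHV` = stmt-QuantumFields-27364 (helper lane, `--kind proof --supports 27364 --as helper`,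
count-neutral).  [III] = [Balaban1988Convergent], [I] = [Balaban1987RG1].  Over this seat's `…N11CompatibleInitialSegmentSplit` (the last compatible level `n₀` of a (2.6)-run and its
one-block tail), p618164 `…N11OneBlockLevels` (`eq_empty_or_eq_univ_of_mem_unionsOfCubes_of_le`: at a one-block side a union of grid cubes is `∅` or the torus), r11's (2.1)-chains
`B14.Eq218Concrete.Seq ∕ Chain21` (`Ω_antitone`, `Λ_antitone`, `Λ_subset`, `Ω_succ_subset`), node00-def-T's `Node00.SeqOfRecord ∕ DOfRecord ∕ Zreg` (`StepWeightsOfRecord`).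

WHY THIS FILE.  Below the floor the no-expansion 𝐓-step ∕ K0's row P11 ∕ the witness chain meet ONE-BLOCK levels (p615408 ∕ p617030 ∕ p618164; BG-ONEBLOCK p624439, dag-n11-w5), and
`…N11CompatibleInitialSegmentSplit` shows that along a (2.6)-run these form a TOP SEGMENT `n₀ < j ≤ K`.  What do the (2.18) summation indices — the histories `s = ({Ω_j}, {Λ_j})`,
`Ω_j, Λ_j ∈ 𝐃_j`, `Λ_j ⊆ Ω_j`, `Ω_{j+1} ⊆ Λ_j` ([III] (2.1)–(2.3)) — look like there?  Since `𝐃_j` at a one-block level contains only `∅` and `T` (p618164), each history is, on the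
tail, a STAIRCASE: all-small (`Ω = Λ = T`) up to some level, possibly one level with `(Ω, Λ) = (T, ∅)`, and dead (`Ω = Λ = ∅`) after — and `Λ_j = T` at ANY level `j` (one-block or
not) already forces the all-small history below `j`.  So the consumers' case analysis at one-block levels is EXACTLY the two extreme branches the tree has typed (dag-n11-w1's ALL-SMALL
faces `…N11AllSmallEmptyExt` — `Zreg_eq_empty_of_Λ` — and the all-large ∕ dead faces `…N11NoExpansionAllLargeCoP`, `…N11AllLargeFieldLabel`), plus the single switch level; in
particular at a one-block TOP level `k` the large-field region `Z_k = Λ_kᶜ` is `∅` (all small: the background is the GLOBAL minimiser on the whole torus — N07's regime, as this seat's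
RUN-GUARD memo located) or `T` (all large: no small-field analysis at all).  This file types that case list once, set-theoretically, for dag-n11-d ∕ dag-n11-w5 ∕ dag-n11-w1 to cite.

WHAT THIS FILE PROVES (0 `sorry`, 0 `def`; standard axioms; pure set theory on the tree's objects).
§1 (any (2.1)-chain `s : Seq D k`): `allSmall_below_of_Λ_eq_univ` (`Λ_j = T ⇒ Ω_i = Λ_i = T` for `1 ≤ i ≤ j`) · `dead_above_of_Ω_eq_empty` (`Ω_j = ∅ ⇒ Ω_i = Λ_i = ∅` for `j ≤ i ≤ k`) ·
   `dead_above_of_Λ_eq_empty` (`Λ_j = ∅ ⇒ Ω_i = Λ_i = ∅` for `j < i ≤ k`).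
§2 (sequences of record at a one-block level `1 ≤ j ≤ k`): ★★ `Ω_eq_empty_or_univ_of_oneBlock` · ★★ `Λ_eq_empty_or_univ_of_oneBlock` · ★★★ `pattern_of_oneBlock` (the trichotomy
   `(T,T) ∨ (T,∅) ∨ (∅,∅)`) · ★★ `allSmall_or_dead_above_of_oneBlock` (`Λ_j = T` and all-small below, OR everything above `j` dead) · ★★ `present_of_oneBlock` (a 𝐓-PRESENT history `Ω_j ≠ ∅` is
   all-small below `j` with `Λ_j ∈ {T, ∅}` — exactly two present children) · ★★ `Zreg_eq_empty_or_univ_of_oneBlock` (one-block TOP level: `Z_k = ∅ ∨ Z_k = T`).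
§3 along a (2.6)-run (generic θ, `M = L^a`, `r = 1`, window, `0 ≤ β⁺`, `β⁺γ² ≤ 1`): ★★★ `exists_split_histories_of_window_of_flowIneq26` (∃ `n₀ ≤ K`: `PartCompat₁₃ θ p n₀` and, for EVERY
   history `s : SeqOfRecord … k` of every level `k ≤ K` and every `n₀ < j ≤ k`, the trichotomy at `j`) · leaves edition `exists_split_histories_of_smallCouplings_of_flowControl` · ★★
   `pattern_all_of_not_dvd_one_of_flowIneq26` (level 1 does not fit ⟹ staircases at EVERY level of every history — the families entirely below the floor).

HONEST FRAMING.  Helper lane of K1⁹; count-neutral set-theoretic bookkeeping on the tree's own definitions; (2.6), the window, `M = L^a` are HYPOTHESES where used; nothing of Bałaban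
asserted; NOT a discharge.  N11 NOT discharged; K1⁹ NOT closed, no registered stub of v9 touched; counts unmoved (typed 28∕28 · discharged 5∕27 · A 5∕28).  One finite `𝕋⁴_{L^K}`
programme at fixed `ε = L^{−K}`; R4 closes only the conditional finite-𝕋⁴ rung `BalabanLadder.UV` — NOT ℝ⁴, NOT OS, NOT a mass gap, NOT Clay.  No `sorry`, `axiom`, `def`, `instance`,
`notation`.  Sources (SHAPE ∕ bookkeeping only): [III] (2.1)–(2.3) pp.254–255, (2.17)–(2.18) p.257, p.264 («the term has a large field region Z_k = Λ_kᶜ»), (2.6) p.255; [I] (0.1) p.251.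
-/

noncomputable section

namespace Summit.QuantumFields.YangMills.Theorems.BalabanUVNodesN11OneBlockTailHistories

open Literature.MathematicalPhysics.QuantumFieldTheory.Balaban1983to89 T4Continuum Node00 DagBinding B14.Eq218Concrete
open BalabanUVNodesN11OneBlockLevels (eq_empty_or_eq_univ_of_mem_unionsOfCubes_of_le)
open BalabanUVNodesN11CompatibleInitialSegmentSplit (exists_lastCompatibleLevel_of_window_of_flowIneq26 exists_lastCompatibleLevel_of_smallCouplings_of_flowControl
  oneBlock_iff_not_dvd_of_powM)
open BalabanUVNodesN11RunGuardOfFlowControl (not_dvdAt_mono_of_flowIneq26)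

/-! ## §1  Any (2.1)-chain: `Λ_j = T` forces all-small below, `Ω_j = ∅` ∕ `Λ_j = ∅` kill everything above -/

section Chain

variable {α : Type*} {D : ℕ → Set (Set α)} {k : ℕ}

/-- **`Λ_j = T` FORCES THE ALL-SMALL HISTORY BELOW `j`**: along a (2.1)-chain (`Λ_i ⊆ Ω_i`, `Ω_{i+1} ⊆ Λ_i`), if `Λ_j = T` (`j ≤ k`) then `Ω_i = T` and `Λ_i = T` for every `1 ≤ i ≤ j`
(`Λ` is antitone and `Λ_i ⊆ Ω_i`).  No one-block hypothesis. [cite: Balaban1988Convergent, (2.1) p.254] -/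
theorem allSmall_below_of_Λ_eq_univ (s : Seq D k) {j : ℕ} (hj : j ≤ k) (hΛ : s.Λ j = Set.univ) {i : ℕ} (h1 : 1 ≤ i) (hij : i ≤ j) :
    s.Ω i = Set.univ ∧ s.Λ i = Set.univ := by
  have hΛi : s.Λ i = Set.univ :=
    Set.eq_univ_of_univ_subset (hΛ ▸ s.chain.Λ_antitone h1 hij hj)
  exact ⟨Set.eq_univ_of_univ_subset (hΛi ▸ s.chain.Λ_subset i h1 (hij.trans hj)), hΛi⟩

/-- **`Ω_j = ∅` KILLS EVERY LATER LEVEL**: if `Ω_j = ∅` (`1 ≤ j`) then `Ω_i = ∅` and `Λ_i = ∅` for every `j ≤ i ≤ k` (`Ω` antitone, `Λ_i ⊆ Ω_i`). [cite: Balaban1988Convergent, (2.1) p.254] -/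
theorem dead_above_of_Ω_eq_empty (s : Seq D k) {j : ℕ} (h1 : 1 ≤ j) (hΩ : s.Ω j = ∅) {i : ℕ} (hji : j ≤ i) (hi : i ≤ k) :
    s.Ω i = ∅ ∧ s.Λ i = ∅ := by
  have hΩi : s.Ω i = ∅ := Set.eq_empty_of_subset_empty (hΩ ▸ s.chain.Ω_antitone h1 hji hi)
  exact ⟨hΩi, Set.eq_empty_of_subset_empty (hΩi ▸ s.chain.Λ_subset i (h1.trans hji) hi)⟩

/-- **`Λ_j = ∅` KILLS EVERY STRICTLY LATER LEVEL**: if `Λ_j = ∅` (`1 ≤ j`) then `Ω_i = ∅` and `Λ_i = ∅` for every `j < i ≤ k` (`Ω_{j+1} ⊆ Λ_j`). [cite: Balaban1988Convergent, (2.1) p.254] -/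
theorem dead_above_of_Λ_eq_empty (s : Seq D k) {j : ℕ} (h1 : 1 ≤ j) (hΛ : s.Λ j = ∅) {i : ℕ} (hji : j < i) (hi : i ≤ k) :
    s.Ω i = ∅ ∧ s.Λ i = ∅ := by
  have hΩ1 : s.Ω (j + 1) = ∅ := Set.eq_empty_of_subset_empty (hΛ ▸ s.chain.Ω_succ_subset j h1 (Nat.lt_of_lt_of_le hji hi))
  exact dead_above_of_Ω_eq_empty s (by omega) hΩ1 hji hi

end Chain

/-! ## §2  Sequences of record at a one-block level: `Ω_j, Λ_j ∈ {∅, T}` and the three patterns -/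

section OneBlock

variable {F : T4Family} {ν : Stage7Numerics} {M : ℕ} {g : ℕ → ℝ} {K k : ℕ}

/-- **★★ AT A ONE-BLOCK LEVEL `Ω_j` IS `∅` OR THE TORUS**: if the 𝐃_j-cube of record exceeds the torus period (`sitesPerDir 0 ≤ L^j·M·R_j`), then for every (2.18)-index
`s : SeqOfRecord … k` and `1 ≤ j ≤ k`, `s.Ω j ∈ 𝐃_j = {∅, T}`. [cite: Balaban1988Convergent, (2.1) p.254, (2.17) p.257] -/
theorem Ω_eq_empty_or_univ_of_oneBlock (s : SeqOfRecord F ν M g K k) {j : ℕ} (h1 : 1 ≤ j) (hj : j ≤ k)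
    (hone : (F.P K).sitesPerDir 0 ≤ dCubeSide (F.P K).L M (RkOfRecord (F.P K).L ν.r (g j)) j) :
    s.Ω j = ∅ ∨ s.Ω j = Set.univ :=
  eq_empty_or_eq_univ_of_mem_unionsOfCubes_of_le hone (s.chain.memΩ j h1 hj)

/-- **★★ AT A ONE-BLOCK LEVEL `Λ_j` IS `∅` OR THE TORUS.** [cite: Balaban1988Convergent, (2.1) p.254, (2.17) p.257] -/
theorem Λ_eq_empty_or_univ_of_oneBlock (s : SeqOfRecord F ν M g K k) {j : ℕ} (h1 : 1 ≤ j) (hj : j ≤ k)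
    (hone : (F.P K).sitesPerDir 0 ≤ dCubeSide (F.P K).L M (RkOfRecord (F.P K).L ν.r (g j)) j) :
    s.Λ j = ∅ ∨ s.Λ j = Set.univ :=
  eq_empty_or_eq_univ_of_mem_unionsOfCubes_of_le hone (s.chain.memΛ j h1 hj)

/-- **★★★ THE THREE PATTERNS AT A ONE-BLOCK LEVEL**: `(Ω_j, Λ_j) = (T, T)` (all small at `j`), `(T, ∅)` (the switch level) or `(∅, ∅)` (dead) — `(∅, T)` is excluded by `Λ_j ⊆ Ω_j`.
[cite: Balaban1988Convergent, (2.1)–(2.3) pp.254–255, (2.17) p.257] -/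
theorem pattern_of_oneBlock (s : SeqOfRecord F ν M g K k) {j : ℕ} (h1 : 1 ≤ j) (hj : j ≤ k)
    (hone : (F.P K).sitesPerDir 0 ≤ dCubeSide (F.P K).L M (RkOfRecord (F.P K).L ν.r (g j)) j) :
    (s.Ω j = Set.univ ∧ s.Λ j = Set.univ) ∨ (s.Ω j = Set.univ ∧ s.Λ j = ∅) ∨ (s.Ω j = ∅ ∧ s.Λ j = ∅) := by
  rcases Λ_eq_empty_or_univ_of_oneBlock s h1 hj hone with hΛ | hΛ
  · rcases Ω_eq_empty_or_univ_of_oneBlock s h1 hj hone with hΩ | hΩ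
    · exact Or.inr (Or.inr ⟨hΩ, hΛ⟩)
    · exact Or.inr (Or.inl ⟨hΩ, hΛ⟩)
  · exact Or.inl ⟨(allSmall_below_of_Λ_eq_univ s hj hΛ h1 le_rfl).1, hΛ⟩

/-- **★★ ALL-SMALL BELOW OR DEAD ABOVE**: at a one-block level `1 ≤ j ≤ k`, EITHER `Λ_j = T` and the history is all-small at every level `i ≤ j`, OR `Λ_j = ∅` and the history is dead at
every level `i > j`. [cite: Balaban1988Convergent, (2.1)–(2.3) pp.254–255, (2.17) p.257] -/
theorem allSmall_or_dead_above_of_oneBlock (s : SeqOfRecord F ν M g K k) {j : ℕ} (h1 : 1 ≤ j) (hj : j ≤ k)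
    (hone : (F.P K).sitesPerDir 0 ≤ dCubeSide (F.P K).L M (RkOfRecord (F.P K).L ν.r (g j)) j) :
    (s.Λ j = Set.univ ∧ ∀ i, 1 ≤ i → i ≤ j → s.Ω i = Set.univ ∧ s.Λ i = Set.univ) ∨
      (s.Λ j = ∅ ∧ ∀ i, j < i → i ≤ k → s.Ω i = ∅ ∧ s.Λ i = ∅) := by
  rcases Λ_eq_empty_or_univ_of_oneBlock s h1 hj hone with hΛ | hΛ
  · exact Or.inr ⟨hΛ, fun i hji hi => dead_above_of_Λ_eq_empty s h1 hΛ hji hi⟩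
  · exact Or.inl ⟨hΛ, fun i hi1 hij => allSmall_below_of_Λ_eq_univ s hj hΛ hi1 hij⟩

/-- **★★ THE 𝐓-PRESENT CHILDREN AT A ONE-BLOCK LEVEL** (`s.Ω j ≠ ∅`, the case of dag-n11-e's `SupplierObligations.present`): at a one-block level `1 ≤ j ≤ k` a present history has
`Ω_j = T`, is ALL-SMALL at every earlier level (`Ω_i = Λ_i = T`, `1 ≤ i < j`, via `Ω_j ⊆ Λ_{j−1}`), and has `Λ_j = T` (all small through `j`) or `Λ_j = ∅` (the switch level) — exactly TWO
present children. [cite: Balaban1988Convergent, (2.1)–(2.3) pp.254–255, (2.17)–(2.18) p.257, (3.20) p.269] -/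
theorem present_of_oneBlock (s : SeqOfRecord F ν M g K k) {j : ℕ} (h1 : 1 ≤ j) (hj : j ≤ k)
    (hone : (F.P K).sitesPerDir 0 ≤ dCubeSide (F.P K).L M (RkOfRecord (F.P K).L ν.r (g j)) j) (hne : s.Ω j ≠ ∅) :
    s.Ω j = Set.univ ∧ (∀ i, 1 ≤ i → i < j → s.Ω i = Set.univ ∧ s.Λ i = Set.univ) ∧ (s.Λ j = Set.univ ∨ s.Λ j = ∅) := by
  have hΩ : s.Ω j = Set.univ := (Ω_eq_empty_or_univ_of_oneBlock s h1 hj hone).resolve_left hne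
  refine ⟨hΩ, fun i hi1 hij => ?_, (Λ_eq_empty_or_univ_of_oneBlock s h1 hj hone).symm⟩
  obtain ⟨j', rfl⟩ : ∃ j', j = j' + 1 := ⟨j - 1, by omega⟩
  have hΛj' : s.Λ j' = Set.univ :=
    Set.eq_univ_of_univ_subset (hΩ ▸ s.chain.Ω_succ_subset j' (by omega) (Nat.lt_of_lt_of_le (Nat.lt_succ_self j') hj))
  exact allSmall_below_of_Λ_eq_univ s (by omega) hΛj' hi1 (by omega)

/-- **★★ AT A ONE-BLOCK TOP LEVEL THE LARGE-FIELD REGION IS NOTHING OR EVERYTHING**: `Z_k = Λ_kᶜ ∈ {∅, T}` for every term of (2.18) at a level `k ≥ 1` whose 𝐃_k-cube exceeds the torus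
— all small (the background is the global minimiser on the whole torus) or all large (no small-field region). [cite: Balaban1988Convergent, (2.3) p.255, p.264, (2.17) p.257] -/
theorem Zreg_eq_empty_or_univ_of_oneBlock (p : B12.RunParams) (s : SeqOfRecord F ν M g p.K k) (hk : 1 ≤ k)
    (hone : (F.P p.K).sitesPerDir 0 ≤ dCubeSide (F.P p.K).L M (RkOfRecord (F.P p.K).L ν.r (g k)) k) :
    Zreg F ν M p g k s = ∅ ∨ Zreg F ν M p g k s = Set.univ := by
  unfold Zreg
  rw [if_pos hk]
  rcases Λ_eq_empty_or_univ_of_oneBlock s hk le_rfl hone with hΛ | hΛ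
  · exact Or.inr (by rw [hΛ, Set.compl_empty])
  · exact Or.inl (by rw [hΛ, Set.compl_univ])

end OneBlock

/-! ## §3  Along a (2.6)-run: print's histories up to `n₀`, staircases above -/

section Run

variable {F : T4Family} {N : ℕ} [NeZero N]

/-- **★★★ THE HISTORIES OF A (2.6)-RUN SPLIT AT THE LAST COMPATIBLE LEVEL** (generic θ, `M = L^a`, `r = 1`, window `]0, γ]`, (2.6) with `0 ≤ β⁺`, `β⁺·γ² ≤ 1`): there is `n₀ ≤ K` with
`PartCompat₁₃ θ p n₀` (print's compatible partitions at the scales `1, …, n₀`) such that for EVERY level `k ≤ K`, EVERY (2.18)-index `s : SeqOfRecord … k` and EVERY `n₀ < j ≤ k` the history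
at `j` is one of the three one-block patterns `(T,T)`, `(T,∅)`, `(∅,∅)`. [cite: Balaban1988Convergent, (2.6) p.255, (2.1)–(2.3) pp.254–255, (2.17)–(2.18) p.257; Balaban1987RG1, (0.1) p.251] -/
theorem exists_split_histories_of_window_of_flowIneq26 (θ : Stage13Params F N) {a : ℕ} (hM : θ.τ9.M = F.L ^ a) (hr : θ.ν.r = 1)
    (p : B12.RunParams) {γ βup β₀ : ℝ} (hβ : 0 ≤ βup) (hβγ : βup * γ ^ 2 ≤ 1)
    (hW : Step.InInterval γ p.K (gOfRecord₁₃ F N θ p))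
    (h26 : B14.FlowIneq26 (gOfRecord₁₃ F N θ p) βup β₀ p.K) :
    ∃ n₀, n₀ ≤ p.K ∧ PartCompat₁₃ F N θ p n₀ ∧
      ∀ k, k ≤ p.K → ∀ s : SeqOfRecord F θ.ν θ.τ9.M (gOfRecord₁₃ F N θ p) p.K k, ∀ j, n₀ < j → j ≤ k →
        (s.Ω j = Set.univ ∧ s.Λ j = Set.univ) ∨ (s.Ω j = Set.univ ∧ s.Λ j = ∅) ∨ (s.Ω j = ∅ ∧ s.Λ j = ∅) := by
  obtain ⟨n₀, hn₀, hPC, htail⟩ := exists_lastCompatibleLevel_of_window_of_flowIneq26 θ hM hr p hβ hβγ hW h26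
  exact ⟨n₀, hn₀, hPC, fun k hk s j hj hjk =>
    pattern_of_oneBlock s (by omega) hjk (htail j hj (hjk.trans hk)).le⟩

/-- **★★★ THE SAME FROM N11's OWN ANTECEDENTS** at a world whose run couplings are the record's (`(w.C P).flow.g = gOfRecord₁₃ θ P`; `0 ≤ w.βup`, `w.βup·w.γ² ≤ 1`): the leaves
`(leavesP w P).smallCouplings` and `(leavesP w P).flowControl` give the split of every (2.18)-history of the run into print's part and a one-block staircase.
[cite: Balaban1988Convergent, (2.6) p.255, (2.1)–(2.3) pp.254–255, (2.17)–(2.18) p.257, Thm 1 p.262; Balaban1987RG1, Thm 1 p.259] -/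
theorem exists_split_histories_of_smallCouplings_of_flowControl (θ : Stage13Params F N) {a : ℕ} (hM : θ.τ9.M = F.L ^ a) (hr : θ.ν.r = 1)
    (w : WorldP) (hβ : 0 ≤ w.βup) (hβγ : w.βup * w.γ ^ 2 ≤ 1) (P : B12.RunParams) (hg : (w.C P).flow.g = gOfRecord₁₃ F N θ P)
    (hsc : (leavesP w P).smallCouplings) (hfc : (leavesP w P).flowControl) :
    ∃ n₀, n₀ ≤ P.K ∧ PartCompat₁₃ F N θ P n₀ ∧
      ∀ k, k ≤ P.K → ∀ s : SeqOfRecord F θ.ν θ.τ9.M (gOfRecord₁₃ F N θ P) P.K k, ∀ j, n₀ < j → j ≤ k →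
        (s.Ω j = Set.univ ∧ s.Λ j = Set.univ) ∨ (s.Ω j = Set.univ ∧ s.Λ j = ∅) ∨ (s.Ω j = ∅ ∧ s.Λ j = ∅) := by
  obtain ⟨n₀, hn₀, hPC, htail⟩ := exists_lastCompatibleLevel_of_smallCouplings_of_flowControl θ hM hr w hβ hβγ P hg hsc hfc
  exact ⟨n₀, hn₀, hPC, fun k hk s j hj hjk =>
    pattern_of_oneBlock s (by omega) hjk (htail j hj (hjk.trans hk)).le⟩

/-- **★★ A RUN WHOSE FIRST LEVEL IS ONE-BLOCK IS ONE-BLOCK THROUGHOUT, SO EVERY (2.18) HISTORY IS A STAIRCASE** (generic θ, `M = L^a`, `r = 1`, window, (2.6) with `0 ≤ β⁺`, `β⁺γ² ≤ 1`;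
the families «entirely below the floor» of p622523): if the level-`1` 𝐃-cube does not divide the torus period then (upward closure, p630366 `not_dvdAt_mono_of_flowIneq26`) no level fits,
and every index `s : SeqOfRecord … k`, `k ≤ K`, shows one of the three patterns at EVERY level `1 ≤ j ≤ k`. [cite: Balaban1988Convergent, (2.6) p.255, (2.1)–(2.3) pp.254–255, (2.17)–(2.18) p.257; Balaban1987RG1, (0.1) p.251] -/
theorem pattern_all_of_not_dvd_one_of_flowIneq26 (θ : Stage13Params F N) {a : ℕ} (hM : θ.τ9.M = F.L ^ a) (hr : θ.ν.r = 1)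
    (p : B12.RunParams) {γ βup β₀ : ℝ} (hβ : 0 ≤ βup) (hβγ : βup * γ ^ 2 ≤ 1)
    (hW : Step.InInterval γ p.K (gOfRecord₁₃ F N θ p))
    (h26 : B14.FlowIneq26 (gOfRecord₁₃ F N θ p) βup β₀ p.K)
    (h1 : ¬ dCubeSide (F.P p.K).L θ.τ9.M (RkOfRecord (F.P p.K).L θ.ν.r (gOfRecord₁₃ F N θ p 1)) 1 ∣ (F.P p.K).sitesPerDir 0)
    {k : ℕ} (hk : k ≤ p.K) (s : SeqOfRecord F θ.ν θ.τ9.M (gOfRecord₁₃ F N θ p) p.K k) {j : ℕ} (hj1 : 1 ≤ j) (hjk : j ≤ k) :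
    (s.Ω j = Set.univ ∧ s.Λ j = Set.univ) ∨ (s.Ω j = Set.univ ∧ s.Λ j = ∅) ∨ (s.Ω j = ∅ ∧ s.Λ j = ∅) :=
  pattern_of_oneBlock s hj1 hjk
    ((oneBlock_iff_not_dvd_of_powM θ hM p j).2
      (not_dvdAt_mono_of_flowIneq26 θ hM hr p hβ hβγ hW h26 le_rfl hj1 (hjk.trans hk) h1)).le

end Run

end Summit.QuantumFields.YangMills.Theorems.BalabanUVNodesN11OneBlockTailHistories

end
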